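import Summits.BirchSwinnertonDyer.BirchSwinnertonDyer.Theses.SignedBaseChange
import Summits.BirchSwinnertonDyer.BirchSwinnertonDyer.Theorems.SignedBaseChangeAnticyclotomicEisensteinDivisibilityOfFactsRefereed
import Summits.BirchSwinnertonDyer.BirchSwinnertonDyer.Theorems.SignedBaseChangeAnticyclotomicEisensteinDivisibilityS1OfSignedEisenstein
import Summits.BirchSwinnertonDyer.BirchSwinnertonDyer.Theorems.SignedBaseChangeAnticyclotomicEisensteinDivisibilityBdpLowerHalfAllAdditive
import Summits.BirchSwinnertonDyer.BirchSwinnertonDyer.Theorems.SignedBaseChangeAnticyclotomicEisensteinDivisibilityOrdinary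
import Summits.BirchSwinnertonDyer.BirchSwinnertonDyer.Theorems.SignedBaseChangeAnticyclotomicEisensteinDivisibilityXAcTorsionOfLongoVigni
import Summits.BirchSwinnertonDyer.BirchSwinnertonDyer.Theorems.SignedBaseChangeAnticyclotomicEisensteinDivisibilityMinusIsBDPSupersingular
import Summits.BirchSwinnertonDyer.BirchSwinnertonDyer.Theorems.SignedBaseChangeAnticyclotomicEisensteinDivisibilityGreenbergFiveFacts
import HarnessLib

/-!
# Crux `AnticyclotomicEisensteinDivisibility` (stmt-BirchSwinnertonDyer-20727, route SignedBaseChange), line `bdpline` v26 —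
# the crux ON THE SUB-CELL `p ∤ h_K` from TWO of the four registered stubs: the named-facts conjunction and the
# research stub S1⁻ (`stub_signedEisensteinSS_coprime`); the two `p ∣ h_K` stubs (a2) and S1∣ are NOT used

Lead prover `bsd-line-sbc-p1` gen 5 (cell `bsd-ssimc`), `--supports stmt-BirchSwinnertonDyer-20727`. THEOREM ONLY (no definition,
no named fact, no `sorry`).

WHY. In the registered skeleton `Cruxes/AnticyclotomicEisensteinDivisibility/Lines/bdpline.lean` v26 (sha16 cbc89a6a) the crux follows from
four stubs: `stub_namedFactsSS` (eleven TYPED named facts), `stub_signedEisensteinSS_coprime` (RESEARCH, Form T, `p ∤ h_K`),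
`stub_xAcTorsionSS_classDvd` ((a2): `X_ac` is `Λ`-torsion at `p ∣ h_K`, only the OPEN preprint claim CCSS18 Thm. 5.7) and
`stub_bdpLowerHalfRatSS_classDvd` (RESEARCH: S1 at `p ∣ h_K`). The last two exist ONLY because the crux quantifies over every Heegner
field `K`, including those with `p ∣ h_K`, where no anticyclotomic signed theory is in print (the primes above `p` need not be totally
ramified in `K_∞⁻`). THIS FILE proves the crux's registered text WITH ONE EXTRA BINDER `¬ p ∣ NumberField.classNumber K` (inserted
after `κ₂.IsAnticyclotomic →`, the position it has in the stubs (a1)/(a2)/S1⁻/S1∣) from the two stubs `stub_namedFactsSS` and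
`stub_signedEisensteinSS_coprime` ALONE — so that, if the planner restates the crux with that binder (the parent K1″
`TwistPairGreenbergProductDivisibilityCanonical` quantifies `K` EXISTENTIALLY, and a Heegner field with `2` split, prescribed odd primes
split and `p ∤ h_K` is supplied by the tree's `BiquadraticEisensteinDescentHeegnerFieldSupplyEvenRung.exists_twoSplit_split_not_dvd_classNumber`
modulo the refereed fact `Literature.NumberTheory.QuadraticFields.BRR2022_thm_1` — companion files of this seat), the line's skeleton has
TWO stubs, one of them the named-facts conjunction.

PROOF. Verbatim the registered composition `SignedBaseChangeAcDivOfFactsRefereed.anticyclotomicEisensteinDivisibility_of_xAcTorsionSS`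
(lead gen 3, p633742): ordinary slice from Yan–Zhu ×3 (p550979); at a supersingular prime `Module.Finite Λ₂ X_Gr₂` (Nakayama + finite
piece), torsion of `X_Gr₂` from the ONE-variable torsion of `X_ac` — here taken from the REFEREED road (a1)
`SignedBaseChangeAcDivXAcTorsionOfLongoVigni.xAcTorsionSS_of_longoVigni_castellaWan` (Longo–Vigni 2019 Thm. 1.4 + Castella–Wan 2024 Thm. 6.8
inputs, p632902), which is where `p ∤ h_K` is consumed —, finite exponent from the Greenberg facts (the sixth, Greenberg 2006 §5 A, is a
tree theorem: `SignedBaseChangeAcDivGreenbergFiveFacts.greenberg2016FactsSS_of_five`, p637745), rational specialisation `T₁ ↦ 0`, S3 from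
BSTW24 Prop. 6.27 (i) (PRE) + BCS25 Prop. 4.2.2, and S1 on the coprime cell by the v24 two-way split: every bad prime additive ⟶ the
Bertolini–Longo–Venerucci conjunct through `SignedBaseChangeAcDivBdpLowerHalfAllAdditive.bdpLowerHalfRatSS_allAdditive_of_BLV` (p637797;
flag `BLV-step4-UNSOURCED-on-R4`), otherwise Form T through the width seat's
`SignedBaseChangeAcDivS1OfSignedEisenstein.bdpLowerHalfRatSS_coprime_of_signedEisenstein` (p636665); then `μ(G⁻) = 0` and the one-variable
cancellation. CONDITIONAL on the two displayed hypotheses (= the two stub statements, verbatim); closes nothing by itself; the registered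
crux (no class-number binder) is NOT proved here. No summit statement / BSD is proved by this file.

References: [LongoVigni2019] Boll. UMI 12 (2019) Thm. 1.4; [CastellaWan2023] Math. Ann. 389 (2024) Thm. 6.8; [YanZhu2024MainConjNonCM]
Thms. 3.3, 4.2 (2), 4.7; [Greenberg2016Selmer] Props. 4.1.1/4.2.2; [Greenberg2006] Props. 3.2/4.1/4.2; [BurungaleSkinnerTianWan2024]
Prop. 6.27 (i) (PRE); [BurungaleCastellaSkinner2025] Prop. 4.2.2; [BertoliniLongoVenerucci2026] Thm. A; [BeckwithRaumRichter2022] Thm. 1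
(the supply fact, used by the companion files only).
-/

-- `Summit.BirchSwinnertonDyer.BirchSwinnertonDyer.…`: summit and sub-problem share a name (D-0017 layout).
set_option linter.dupNamespace false
set_option autoImplicit false

noncomputable section

open scoped Classical

namespace Summit.BirchSwinnertonDyer.BirchSwinnertonDyer.Theorems.SignedBaseChangeAcDivCoprimeClassNumber

open Summit.BirchSwinnertonDyer.BirchSwinnertonDyer.Theses.SignedBaseChange
open Literature.NumberTheory.EllipticCurves
open Summit.BirchSwinnertonDyer.BirchSwinnertonDyer.Theorems

/-- **The crux `AnticyclotomicEisensteinDivisibility` with the extra binder `¬ p ∣ h_K`, from the two stubs `stub_namedFactsSS` (`hF`,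
verbatim) and `stub_signedEisensteinSS_coprime` (`hT`, verbatim) of skeleton `bdpline` v26.** The registered composition (p633742) with
the one-variable torsion input taken from the refereed road (a1) (Longo–Vigni 2019 Thm. 1.4 + Castella–Wan 2024 Thm. 6.8 inputs, which
consume `p ∤ h_K`) and S1 on the coprime cell by the v24 split (all-additive ⟶ the BLV conjunct; otherwise Form T). CONDITIONAL on
the two displayed hypotheses; the registered crux (every `K`) is not proved here; BSD is not advanced.
[cite: LongoVigni2019, Thm. 1.4] [cite: CastellaWan2023, Thm. 6.8 and its proof (MS pp. 29–31)]
[cite: YanZhu2024MainConjNonCM, Thms. 3.3, 4.2 (2), 4.7] [cite: BurungaleCastellaSkinner2025, Prop. 4.2.2]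
[claim: BurungaleSkinnerTianWan2024, status: under-review] [cite: Greenberg2016Selmer, Prop. 4.1.1]
[cite: BertoliniLongoVenerucci2026, Thm. A with Hyp. 1.1] -/
theorem anticyclotomicEisensteinDivisibility_coprime_of_stubs
    (hF : (Literature.NumberTheory.EllipticCurves.YanZhu2026.thm42_XGr₂_isTorsion_charIdeal_le_greenbergAnyRoot ∧
      Literature.NumberTheory.EllipticCurves.YanZhu2026.thm47_ord_localised_iff_greenbergAnyRoot_localised_guarded ∧
      Literature.NumberTheory.EllipticCurves.YanZhu2026.thm33_exists_isHidaRankinLFunction) ∧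
      (∀ (W : WeierstrassCurve ℚ) [W.IsGloballyMinimal] (K : Type) [Field K] [NumberField K] (p : ℕ) [Fact p.Prime]
      (κ : Literature.NumberTheory.EllipticCurves.ZpExtension K p) (𝔭 𝔭' : IsDedekindDomain.HeightOneSpectrum (NumberField.RingOfIntegers K)),
      Literature.NumberTheory.EllipticCurves.AcSigned.longoVigni2019_thm14_signedSelmerDual_rank_one W K p κ 𝔭 𝔭') ∧
      (∀ (N : ℕ) [NeZero N] (W : WeierstrassCurve ℚ) [W.IsGloballyMinimal] (K : Type) [Field K] [NumberField K] (p : ℕ) [Fact p.Prime]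
      (κ : Literature.NumberTheory.EllipticCurves.ZpExtension K p) (𝔭 𝔭' : IsDedekindDomain.HeightOneSpectrum (NumberField.RingOfIntegers K)),
      Literature.NumberTheory.EllipticCurves.AcSigned.castellaWan2024_proofThm68_transferInputs N W K p κ 𝔭 𝔭') ∧
      (∀ (N : ℕ) [NeZero N] (W : WeierstrassCurve ℚ) [W.IsGloballyMinimal] (K : Type) [Field K] [NumberField K] (p : ℕ) [Fact p.Prime]
      (κ : Literature.NumberTheory.EllipticCurves.ZpExtension K p) (𝔭 𝔭' : IsDedekindDomain.HeightOneSpectrum (NumberField.RingOfIntegers K)),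
      Literature.NumberTheory.EllipticCurves.AcSigned.castellaWan2024_lemma67_finrank_torsionCharIdeal N W K p κ 𝔭 𝔭') ∧
      (∀ (N : ℕ) [NeZero N] (W : WeierstrassCurve ℚ) [W.IsGloballyMinimal] (K : Type) [Field K] [NumberField K] (p : ℕ) [Fact p.Prime]
      (κ : Literature.NumberTheory.EllipticCurves.ZpExtension K p) (𝔭 𝔭' : IsDedekindDomain.HeightOneSpectrum (NumberField.RingOfIntegers K)),
      Literature.NumberTheory.EllipticCurves.AcSigned.castellaWan2024_proofThm68_selmerRel_le_selmerSgn N W K p κ 𝔭 𝔭') ∧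
      Literature.NumberTheory.EllipticCurves.BertoliniLongoVenerucci2026.thmA_castellaWan_thm68_exists_isCWBDPLFunction_charIdeal_map_le_rat ∧
      (Literature.NumberTheory.IwasawaTheory.Greenberg2016.prop411_selmer_isAlmostDivisible ∧
      Literature.NumberTheory.IwasawaTheory.Greenberg2016.prop422_localCohomology_isAlmostDivisible ∧
      Literature.NumberTheory.IwasawaTheory.Greenberg2006.prop41_globalEulerPoincareCorank ∧
      Literature.NumberTheory.IwasawaTheory.Greenberg2006.prop42_localEulerPoincareCorank ∧
      Literature.NumberTheory.IwasawaTheory.Greenberg2006.prop32_cohomology_isCofinitelyGenerated) ∧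
      Literature.NumberTheory.EllipticCurves.BurungaleSkinnerTianWan2024.prop627_span_minus_eq_span_bdp_supersingular_PRE ∧
      Literature.NumberTheory.EllipticCurves.BurungaleCastellaSkinner2025.prop422_exists_isBDPLFunction_mu_eq_zero)
    (hT : SignedTwoVariableInputs → Literature.NumberTheory.EllipticCurves.ModularForms.nonempty_modularParametrizationData → ∀ (W : WeierstrassCurve ℚ) [W.IsElliptic] [W.IsGloballyMinimal] (p : ℕ) [Fact p.Prime], 5 ≤ p → W.HasGoodReductionAtPrime p → W.frobeniusTrace p = 0 → Literature.NumberTheory.EllipticCurves.Rank1Residual.Surj W p → ∀ (K : Type) [Field K] [NumberField K] (ι : PadicAlgCl p ≃+* ℂ) (v vbar : IsDedekindDomain.HeightOneSpectrum (NumberField.RingOfIntegers K)) (κ₁ κ₂ : Literature.NumberTheory.EllipticCurves.ZpExtension K p) (γ₁ γ₂ : Field.absoluteGaloisGroup K) [Fact (Literature.NumberTheory.EllipticCurves.ZpExtension.IsTopGeneratorPair κ₁ κ₂ γ₁ γ₂)] [NeZero (NumberField.discr K).natAbs] (N : ℕ) [NeZero N] (f : CuspForm (CongruenceSubgroup.Gamma0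 N) 2), Literature.NumberTheory.EllipticCurves.ModularForms.IsNewformOf W f → (N : ℤ) = W.conductorNorm ℤ → Literature.NumberTheory.EllipticCurves.IsImaginaryQuadratic K → ¬ p ∣ NumberField.classNumber K → ((Ideal.span {(p : ℤ)}).primesOver (NumberField.RingOfIntegers K)).ncard = 2 → ((p : ℕ) : NumberField.RingOfIntegers K) ∈ v.asIdeal → ((p : ℕ) : NumberField.RingOfIntegers K) ∈ vbar.asIdeal → vbar ≠ v → (∀ (w : NumberField.InfinitePlace K) (k : NumberField.RingOfIntegers K), k ∈ v.asIdeal ↔ ‖ι.symm (w.embedding (k : K))‖ < 1) → IsCoprime (N : ℤ) (NumberField.discr K) → (∀ ℓ : ℕ, ℓ.Prime → ℓ ∣ N → ((Ideal.span {(ℓ : ℤ)}).primesOver (NumberField.RingOfIntegers K)).ncard = 2) → Odd (NumberField.discr K) → NumberField.discr K ≠ -3 → κ₁.IsCyclotomic → κ₂.IsAnticyclotomic → ∀ (h𝔭 : AcSigned.IsNonsplitIn κ₂ v) (γ𝔭 : Field.absoluteGaloisGroup (v.adicCompletion K)) (hγ𝔭 : κ₂ (resGalOfEmb (closureEmb (K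 := K) (v.adicCompletion K)) γ𝔭) = κ₂ γ₂) (hne : v ≠ vbar) (hvp : ((p : ℕ) : NumberField.RingOfIntegers K) ∈ v.asIdeal) (ΩK : ℂ) (Ωp : (unrIntegers p)ˣ) (L : UnrSeries p) (z : AcSigned.selmerLambdaAdic (W.baseChange K) p κ₂ γ₂ (fun _ ↦ .sgn 1)), ΩK ≠ 0 → CastellaWan2024.IsCWBDPLFunction ι v κ₂ γ₂ f (NumberField.discr K) ΩK ((Ωp : unrIntegers p) : PadicComplex p) L → AcSigned.TransferInputs (W.baseChange K) p κ₂ γ₂ (YanZhu2026.isTopGenerator_of_pair (κ₁ := κ₁) (γ₁ := γ₁) : κ₂.IsTopGenerator γ₂) v h𝔭 γ𝔭 hγ𝔭 vbar hne hvp 1 z L → ∃ k : ℕ, Ideal.span {((p : ℕ) : IwasawaAlgebra p) ^ k} * AcSigned.X.torsionCharIdeal (W.baseChange K) p κ₂ ∅ (fun _ ↦ .sgn 1) (YanZhu2026.isTopGenerator_of_pair (κ₁ := κ₁) (γ₁ := γ₁) : κ₂.IsTopGenerator γ₂) ≤ (AcSigned.signedHeegnerCharIdeal (YanZhu2026.isTopGenerator_of_pair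 (κ₁ := κ₁) (γ₁ := γ₁) : κ₂.IsTopGenerator γ₂) 1 z).map (IwasawaAlgebra.invol p) ^ 2) :
    SignedTwoVariableInputs → Literature.NumberTheory.EllipticCurves.ModularForms.nonempty_modularParametrizationData → ∀ (W : WeierstrassCurve ℚ) [W.IsElliptic] [W.IsGloballyMinimal] (p : ℕ) [Fact p.Prime], 5 ≤ p → W.HasGoodReductionAtPrime p → Literature.NumberTheory.EllipticCurves.Rank1Residual.Surj W p → ∀ (K : Type) [Field K] [NumberField K] (ι : PadicAlgCl p ≃+* ℂ) (v vbar : IsDedekindDomain.HeightOneSpectrum (NumberField.RingOfIntegers K)) (κ₁ κ₂ : Literature.NumberTheory.EllipticCurves.ZpExtension K p) (γ₁ γ₂ : Field.absoluteGaloisGroup K) [Fact (Literature.NumberTheory.EllipticCurves.ZpExtension.IsTopGeneratorPair κ₁ κ₂ γ₁ γ₂)] [NeZero (NumberField.discr K).natAbs] (N : ℕ) [NeZero N] (f : CuspForm (CongruenceSubgroup.Gamma0 N) 2), Literature.NumberTheory.EllipticCurves.ModularForms.IsNewformOf W f → (N : ℤ) = W.conductorNorm ℤ → Literature.NumberTheory.EllipticCurves.IsImaginaryQuadratic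 K → ((Ideal.span {(p : ℤ)}).primesOver (NumberField.RingOfIntegers K)).ncard = 2 → ((p : ℕ) : NumberField.RingOfIntegers K) ∈ v.asIdeal → ((p : ℕ) : NumberField.RingOfIntegers K) ∈ vbar.asIdeal → vbar ≠ v → (∀ (w : NumberField.InfinitePlace K) (k : NumberField.RingOfIntegers K), k ∈ v.asIdeal ↔ ‖ι.symm (w.embedding (k : K))‖ < 1) → IsCoprime (N : ℤ) (NumberField.discr K) → (∀ ℓ : ℕ, ℓ.Prime → ℓ ∣ N → ((Ideal.span {(ℓ : ℤ)}).primesOver (NumberField.RingOfIntegers K)).ncard = 2) → Odd (NumberField.discr K) → NumberField.discr K ≠ -3 → κ₁.IsCyclotomic → κ₂.IsAnticyclotomic → ¬ p ∣ NumberField.classNumber K → ∀ (Ω δ : ℂ) (Ωp : (Literature.NumberTheory.EllipticCurves.unrIntegers p)ˣ) (LK G : PowerSeries (PowerSeries (PadicComplexInt p))), Ω ≠ 0 → (δ ^ 2 = (NumberField.discr K : ℂ) ∨ δ ^ 2 = -(NumberField.discr K : ℂ)) → Literature.NumberTheory.EllipticCurves.IsKatzMeasure₂ ι v vbar ∅ κ₁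 κ₂ γ₁⁻¹ γ₂⁻¹ 1 Ω δ ((Ωp : Literature.NumberTheory.EllipticCurves.unrIntegers p) : PadicComplex p) LK → Literature.NumberTheory.EllipticCurves.IsGreenbergLFunctionAnyRoot₂ ι v vbar κ₁ κ₂ γ₁⁻¹ γ₂⁻¹ f (NumberField.discr K).natAbs (NumberField.classNumber K) LK G → ∀ J : ℤ_[p] →+* PadicComplexInt p, (∀ x : ℤ_[p], ((J x : PadicComplexInt p) : PadicComplex p) = ((x : ℚ_[p]) : PadicComplex p)) → ((WeierstrassCurve.XGr₂.charIdeal (W.baseChange K) p κ₁ κ₂ vbar γ₁ γ₂).map (Literature.NumberTheory.EllipticCurves.IwasawaAlgebra₂.toUnr₂ p J)).map (PowerSeries.constantCoeff (R := PowerSeries (PadicComplexInt p))) ≤ Ideal.span {Literature.NumberTheory.EllipticCurves.UnrSeries₂.minus G} := by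
  -- the named facts, projected
  obtain ⟨⟨h42, h47, h33⟩, hLV, hCW, hL67, hRel, hBLV, ⟨hG1, hG2, hG3, hG4, hG5⟩, h627, h422e⟩ := hF
  have hGr := SignedBaseChangeAcDivGreenbergFiveFacts.greenberg2016FactsSS_of_five hG1 hG2 hG3 hG4 hG5
  intro hIn hmodP W _ _ p _ hp hgood hs K _ _ ι v vbar κ₁ κ₂ γ₁ γ₂ _ _ N _ f hf hN hK hsplit hv hvbar hvv hι hcop hHeeg hodd
    hne3 hκ₁ hκ₂ hh Ω δ Ωp LK G hΩ hδ hLK hG J hJ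
  by_cases hap : ¬ (p : ℤ) ∣ W.frobeniusTrace p
  · -- ordinary slice: print (stub_ordSlice), no class-number input
    exact SignedBaseChangeAcDivOrdinary.acDivChild_of_goodOrd h42 h47 h33 hIn hmodP W p hp hgood ⟨hgood, hap⟩ hs K ι v vbar κ₁ κ₂ γ₁ γ₂ N f hf hN hK hsplit hv hvbar hvv hι hcop hHeeg
      hodd hne3 hκ₁ hκ₂ Ω δ Ωp LK G hΩ hδ hLK hG J hJ
  have ha0 : W.frobeniusTrace p = 0 := (W.natCast_dvd_frobeniusTrace_iff_eq_zero p hp hgood).mp (not_not.mp hap)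
  have hγ₂ : κ₂.IsTopGenerator γ₂ := YanZhu2026.isTopGenerator_of_pair (κ₁ := κ₁) (γ₁ := γ₁)
  haveI : Fact (κ₂.IsTopGenerator γ₂) := ⟨hγ₂⟩
  -- S2a: finite generation = Nakayama for duals over Λ₂ + finiteness of `unrSelmer₂[𝔪]`
  haveI : (W.baseChange K).IsElliptic := by rw [WeierstrassCurve.baseChange]; infer_instance
  have hpair : ZpExtension.IsTopGeneratorPair κ₁ κ₂ γ₁ γ₂ := Fact.out
  have hfin := SignedBaseChangeAcDivFinitePiece.stub_finitePieceSS K (W.baseChange K) p κ₁ κ₂ vbar γ₁ γ₂ hpair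
  haveI hfg : Module.Finite (IwasawaAlgebra₂ p) ((W.baseChange K).XGr₂ p κ₁ κ₂ vbar γ₁ γ₂) := by
    refine SignedBaseChangeAcDivNakayamaTwoVar.stub_nakayamaDualTwoVar p (unrSelmer₂ κ₁ κ₂ (WeierstrassCurve.geomPrimaryTorsion (W.baseChange K) p) vbar)
      ((W.baseChange K).XGr₂ p κ₁ κ₂ vbar γ₁ γ₂)
      (conjSel₂ κ₁ κ₂ (WeierstrassCurve.geomPrimaryTorsion (W.baseChange K) p) vbar γ₁ - 1)
      (conjSel₂ κ₁ κ₂ (WeierstrassCurve.geomPrimaryTorsion (W.baseChange K) p) vbar γ₂ - 1)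
      (AddMonoidHom.id _) Function.bijective_id (fun x s ↦ ?_) (fun x s ↦ ?_) (fun c x s k hk ↦ ?_)
      (TwoVariableSelmer.isLocNil₂_conjSel₂ (WeierstrassCurve.geomPrimaryTorsion (W.baseChange K) p) vbar hpair
        ((W.baseChange K).exists_pow_smul_geomPrimaryTorsion_eq_zero p) ((W.baseChange K).isOpen_stabilizer_geomPrimaryTorsion' p)) ?_
    · show ((PowerSeries.X : IwasawaAlgebra₂ p) • x) s = x ((conjSel₂ κ₁ κ₂ (WeierstrassCurve.geomPrimaryTorsion (W.baseChange K) p) vbar γ₁ - 1) s)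
      rw [WeierstrassCurve.XGr₂.X_smul_apply, IwasawaDual.End_sub_apply, AddMonoid.End.one_apply]
      exact (AddMonoidHom.map_sub (show unrSelmer₂ κ₁ κ₂ (WeierstrassCurve.geomPrimaryTorsion (W.baseChange K) p) vbar →+
        AddCircle (1 : ℚ) from x) _ _).symm
    · show ((PowerSeries.C (PowerSeries.X : IwasawaAlgebra p) : IwasawaAlgebra₂ p) • x) s = x ((conjSel₂ κ₁ κ₂ (WeierstrassCurve.geomPrimaryTorsion (W.baseChange K) p) vbar γ₂ - 1) s)
      rw [WeierstrassCurve.XGr₂.CX_smul_apply, IwasawaDual.End_sub_apply, AddMonoid.End.one_apply]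
      exact (AddMonoidHom.map_sub (show unrSelmer₂ κ₁ κ₂ (WeierstrassCurve.geomPrimaryTorsion (W.baseChange K) p) vbar →+
        AddCircle (1 : ℚ) from x) _ _).symm
    · show ((PowerSeries.C (PowerSeries.C c : IwasawaAlgebra p) : IwasawaAlgebra₂ p) • x) s = (PadicInt.toZModPow k c).val • x s
      exact WeierstrassCurve.XGr₂.CC_smul_apply (W.baseChange K) p κ₁ κ₂ vbar γ₁ γ₂ c x hk
    · refine hfin.subset fun s hs ↦ ?_
      obtain ⟨h0, h1, h2⟩ := hs
      rw [IwasawaDual.End_sub_apply, AddMonoid.End.one_apply, sub_eq_zero] at h1 h2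
      exact ⟨h0, h1, h2⟩
  -- torsion of `X_Gr₂` from the ONE-variable torsion of `X_ac` on the REFEREED road (a1) — the only consumer of `p ∤ h_K`
  have hA1 := SignedBaseChangeAcDivXAcTorsionOfLongoVigni.xAcTorsionSS_of_longoVigni_castellaWan hLV hCW hIn hmodP W p hp hgood
    ha0 hs K ι v vbar κ₁ κ₂ γ₁ γ₂ N f hf hN hK hsplit hv hvbar hvv hι hcop hHeeg hodd hne3 hκ₁ hκ₂ hh
  have hV := SignedBaseChangeAcDivOfFacts.inertiaVanishingSS hIn hmodP W p hp hgood ha0 hs K ι v vbar κ₁ κ₂ γ₁ γ₂ N f hf hN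
    hK hsplit hv hvbar hvv hι hcop hHeeg hodd hne3 hκ₁ hκ₂
  have htors := SignedBaseChangeAcDivControlTorsion.stub_torsionSS_of_isTorsion_XAc_of_vanishing_of_away
    W p hp hgood ha0 hs K ι v vbar κ₁ κ₂ γ₁ γ₂ N f hf hN hK hsplit hv hvbar hvv hι hcop hHeeg hodd hne3 hκ₁ hκ₂ hA1 hV
    (SignedBaseChangeAcDivAwayDiscrepancy.stub_awayDiscrepancySS hIn hmodP W p hp hgood ha0 hs K ι v vbar κ₁ κ₂ γ₁ γ₂ N f hf hN
      hK hsplit hv hvbar hvv hι hcop hHeeg hodd hne3 hκ₁ hκ₂ hV)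
  obtain ⟨fc, hfc⟩ := SignedBaseChangeAcDivControl.stub_controlSurjSS hIn hmodP W p hp hgood ha0 hs K ι v vbar κ₁ κ₂ γ₁ γ₂ N f hf hN hK hsplit hv hvbar hvv hι hcop hHeeg hodd hne3 hκ₁ hκ₂
  obtain ⟨ΩK₃, Ωp₃, L₃, hΩK₃, hL₃, hcmp⟩ :=
    SignedBaseChangeAcDivMinusIsBDPSS.stub_minusIsBDP_ss_of_facts h627 h422e hIn hmodP W p hp hgood ha0 hs K ι v vbar κ₁ κ₂ γ₁ γ₂ N f hf hN hK hsplit hv hvbar hvv hι hcop hHeeg hodd hne3 hκ₁ hκ₂ Ω δ Ωp LK G hΩ hδ hLK hG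
  -- dichotomy on `(T₁) ∈ Supp X_Gr₂`: if so, the specialised ideal is `⊥`
  by_cases h0 : Literature.NumberTheory.EllipticCurves.Module.lengthAt (IwasawaAlgebra₂ p) ((W.baseChange K).XGr₂ p κ₁ κ₂ vbar γ₁ γ₂)
      ⟨Ideal.span {(PowerSeries.X : IwasawaAlgebra₂ p)}, PowerSeries.span_X_isPrime⟩ = 0
  swap
  · rw [show WeierstrassCurve.XGr₂.charIdeal (W.baseChange K) p κ₁ κ₂ vbar γ₁ γ₂ =
        Literature.NumberTheory.EllipticCurves.Module.charIdeal (IwasawaAlgebra₂ p) ((W.baseChange K).XGr₂ p κ₁ κ₂ vbar γ₁ γ₂) from rfl,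
      SignedBaseChangeAcDivSpecialization.S2.map_toUnr₂_map_constantCoeff_eq_bot_of_lengthAt_ne_zero p _ htors h0 J]
    exact bot_le
  -- `(T₁) ∉ Supp X_Gr₂`: a killing element `s` with `s(0) ≠ 0` makes `X_ac` (a quotient of `X_Gr₂/T₁`) `Λ_ac`-torsion
  obtain ⟨s, hsX, hsm⟩ :=
    SignedBaseChangeAcDivSpecialization.LocalLength.exists_notMem_forall_smul_eq_zero_of_lengthAt_eq_zero h0
  have hs0 : PowerSeries.constantCoeff s ≠ 0 := fun h ↦ hsX
    ((SignedBaseChangeAcDivSpecialization.PowerSeriesSpecialization.mem_span_X_iff (A := IwasawaAlgebra p)).mpr h)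
  -- finite exponent of `X_Gr₂[T₁]` from the six Greenberg facts (five typed + §5 A proved)
  have hm := SignedBaseChangeAcDivOfFacts.finiteExponentSS_of_facts hGr hIn hmodP W p hp hgood ha0 hs K ι v vbar κ₁ κ₂ γ₁ γ₂ N f hf hN hK hsplit hv hvbar hvv hι hcop hHeeg hodd hne3 hκ₁ hκ₂ h0
  have hXacTors : Module.IsTorsion (IwasawaAlgebra p) (Castella2018.AcSelmer.XAc (W.baseChange K) p κ₂ vbar ∅ γ₂) := by
    letI : Module (IwasawaAlgebra p) (QuotSMulTop (PowerSeries.X : IwasawaAlgebra₂ p) ((W.baseChange K).XGr₂ p κ₁ κ₂ vbar γ₁ γ₂)) :=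
      Module.compHom _ (PowerSeries.C (R := IwasawaAlgebra p))
    have hq : ∀ q : QuotSMulTop (PowerSeries.X : IwasawaAlgebra₂ p) ((W.baseChange K).XGr₂ p κ₁ κ₂ vbar γ₁ γ₂),
        (PowerSeries.constantCoeff s) • q = 0 := by
      intro q
      show (PowerSeries.C (PowerSeries.constantCoeff s) : IwasawaAlgebra₂ p) • q = 0
      have e : (PowerSeries.C (PowerSeries.constantCoeff s) : IwasawaAlgebra₂ p) =
          (PowerSeries.C (PowerSeries.constantCoeff s) - s) + s := by ring
      obtain ⟨x, rfl⟩ := Submodule.Quotient.mk_surjective _ q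
      rw [e, add_smul,
        SignedBaseChangeAcDivSpecialization.PowerSeriesSpecialization.smul_quotSMulTop_eq_zero
          _ _ (by rw [map_sub, PowerSeries.constantCoeff_C, sub_self]),
        zero_add, ← Submodule.Quotient.mk_smul, hsm, Submodule.Quotient.mk_zero]
    intro y
    obtain ⟨q, rfl⟩ := hfc y
    refine ⟨⟨PowerSeries.constantCoeff s, mem_nonZeroDivisors_of_ne_zero hs0⟩, ?_⟩
    show (PowerSeries.constantCoeff s) • fc q = 0
    rw [← LinearMap.map_smul, hq, map_zero]
  -- μ(G⁻) = 0 from conjunct 1 of the crux's own antecedent (BCS25 Prop. 4.2.2; (irr_K) ⟸ Surj)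
  have hμ : GreenbergVatsal2000.HasUnitContent (UnrSeries₂.minus G) :=
    SignedBaseChangeAcDivRatToInt.hasUnitContent_minus_of_prop422 hIn.1 W hp hgood hs
      K ι v vbar κ₁ κ₂ γ₁ γ₂ hf hN hK hsplit hv hvbar hvv hι hcop hHeeg hodd hne3 hκ₁ hκ₂ hΩ hδ hLK hG
  let J₀ : unrIntegers p →+* PadicComplexInt p := Summit.BirchSwinnertonDyer.Rank1Residual.X11b.R1.unrToCpInt p
  have hJ₀ : ∀ x : unrIntegers p, ((J₀ x : PadicComplexInt p) : PadicComplex p) = (x : PadicComplex p) :=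
    Summit.BirchSwinnertonDyer.Rank1Residual.X11b.R1.coe_unrToCpInt p
  -- RATIONAL specialisation `T₁ ↦ 0`
  obtain ⟨k₂, hk₂⟩ := SignedBaseChangeAcDivSpecialization.S2.xGr₂_specialization_le_rat
    (W.baseChange K) p κ₁ κ₂ vbar γ₁ γ₂ ⟨s, hs0, hsm⟩ hm fc hfc J
  -- S1 on the coprime cell (v24 split): all-additive ⟶ the BLV conjunct; otherwise ⟶ Form T through the width seat's transfer
  obtain ⟨k₁, hk₁⟩ : ∃ k : ℕ, ∀ y ∈ (Castella2018.AcSelmer.XAc.charIdeal (W.baseChange K) p κ₂ vbar ∅ γ₂).map (PowerSeries.map J),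
      PowerSeries.C (((p : ℕ) : PadicComplexInt p) ^ k) * y ∈ Ideal.span {PowerSeries.map J₀ L₃} := by
    by_cases hsq : ∀ ℓ : ℕ, ℓ.Prime → ℓ ∣ N → ℓ ^ 2 ∣ N
    · exact SignedBaseChangeAcDivBdpLowerHalfAllAdditive.bdpLowerHalfRatSS_allAdditive_of_BLV hBLV hIn hmodP W p hp hgood ha0 hs K ι
        v vbar κ₁ κ₂ γ₁ γ₂ N f hf hN hK hsplit hv hvbar hvv hι hcop hHeeg hodd hne3 hκ₁ hκ₂ hh hsq hXacTors ΩK₃ Ωp₃ L₃ hΩK₃ hL₃ J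
        hJ J₀ hJ₀
    · exact SignedBaseChangeAcDivS1OfSignedEisenstein.bdpLowerHalfRatSS_coprime_of_signedEisenstein hT hLV hCW hL67 hRel hIn hmodP W
        p hp hgood ha0 hs K ι v vbar κ₁ κ₂ γ₁ γ₂ N f hf hN hK hh hsplit hv hvbar hvv hι hcop hHeeg hodd hne3 hκ₁ hκ₂ hXacTors ΩK₃
        Ωp₃ L₃ hΩK₃ hL₃ J hJ J₀ hJ₀
  -- rational S2 + rational S1 + μ(G⁻) = 0 ⟹ the integral inclusion (one-variable cancellation, k = k₁ + k₂)
  refine SignedBaseChangeAcDivRatToInt.le_span_of_forall_C_pow_mul_mem_of_hasUnitContent hμ (k := k₁ + k₂) fun y hy ↦ ?_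
  rw [hcmp J₀ hJ₀, pow_add, map_mul, mul_assoc]
  exact hk₁ _ (hk₂ y hy)

end Summit.BirchSwinnertonDyer.BirchSwinnertonDyer.Theorems.SignedBaseChangeAcDivCoprimeClassNumber

end
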